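import Summits.HubbardSuperconductivity.HubbardSuperconductivity.Theorems.BirComplexStableXY.Negative.WitnessTable

/-!
# Sketch — crux-ideate r1 ideator 2, crux `BirComplexStableXYR` (stmt-HubbardSuperconductivity-14845)

Idea `coercivity-budget-jensen-transfer` — first lemmas as Props over existing declarations
(`BirComplexStableXYNegative.{Table, Λ, W, Freq, genF, action, partZ, cube}` from the landed Negative module; the
disprover's `sliceO, numerO, Conclusion, Cond*, AdmissibleRP` are re-declared verbatim below because the crux work
file `Cruxes/BirComplexStableXYR/Disproof.lean` is not yet built on the farm).  Nothing is proved here; everything must elaborate.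

* `sliceD`  — slice magnetisation DEFICIT `D = 1 − O` (rotor-blind, `0 ≤ D ≤ 1`).
* `sliceE`  — spatial Dirichlet energy of slice `0`.
* `rewardZ` — deficit-REWARDED partition function `Z_h = ∫ e^{−A} e^{+h D(θ(·,0))}`.
* `SlicePoincare`        (P1, elementary): `D ≤ E/8` for `L ≥ 2` (spectral gap `4 sin²(π/L) ≥ 16/L²`).
* `JensenDeficitBound`   (J, FIRST LEMMA): `r = 2`, class (R), even `M`, every `h > 0`:
      `1 − log(Re Z_h / Re Z)/h ≤ Re ⟨O⟩`  — Jensen for `exp` under the landed positive slice density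
      (`birEven_positiveDensity`): `E_ρ[e^{hD}] ≥ e^{h E_ρ D}`.
* `CoerciveBudgetFreeEnergy` (FE, the transferred content): with the reward `h = 16 c₀ K` — one quarter of the
      coercive budget of slice 0, since `h D ≤ 2 K c₀ E(θ₀) ≤ ¼ · 8 K c₀ E(θ₀) ≤ ¼ Re A|_{slice 0}` — the
      rewarded complex system stays coercive and its free energy exceeds the unrewarded one by at most `C`:
      `Re Z_{16c₀K} ≤ e^C · Re Z`, uniformly in `K ≥ K₀`, admissible `c`, even `L₀ ≤ L ≤ M`.
* `TransferClaim`: FE → J → the `r = 2` slice of the crux (`⟨O⟩ ≥ 1 − C/(16 c₀ K) ≥ 1/2` for `K ≥ C/(8c₀)`;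
      conjunct 1 is `zne_of_R_r2`).
-/

set_option linter.dupNamespace false

namespace Summit.HubbardSuperconductivity.HubbardSuperconductivity.Cruxes.BirComplexStableXYR.JensenBudget

open scoped BigOperators ComplexConjugate
open MeasureTheory Literature.Probability.LatticeModels
open Summit.HubbardSuperconductivity.HubbardSuperconductivity.Theses.BalabanIR
open Summit.HubbardSuperconductivity.BirComplexStableXYNegative

noncomputable section

/-! ### verbatim copies of the disprover's named pieces (Cruxes/BirComplexStableXYR/Disproof.lean §1) -/

/-- the equal-time slice order observable `O(θ) = |Σ_x e^{iθ(x,0)}|² / L⁴`. -/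
def sliceO (L M : ℕ) [NeZero L] [NeZero M] (θ : Λ L M → ℝ) : ℝ :=
  ‖∑ x : TorusSite 2 L, Complex.exp (Complex.I * (θ (x, 0) : ℂ))‖ ^ 2 / (L : ℝ) ^ 4

/-- the numerator `∫_cube O e^{-A}`. -/
def numerO {r : ℕ} (K : ℝ) (c : Table r) (L M : ℕ) [NeZero L] [NeZero M] : ℂ :=
  MeasureTheory.integral (MeasureTheory.volume.restrict (cube L M))
    (fun θ => (sliceO L M θ : ℂ) * Complex.exp (-(action K c L M θ)))

/-- the crux's conclusion for given data: `Z ≠ 0` and `Re ⟨O⟩ ≥ 1/2`. -/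
def Conclusion {r : ℕ} (K : ℝ) (c : Table r) (L M : ℕ) [NeZero L] [NeZero M] : Prop :=
  partZ K c L M ≠ 0 ∧ (1/2 : ℝ) ≤ (numerO K c L M / partZ K c L M).re

def CondU1 {r : ℕ} (c : Table r) : Prop := ∀ n ∈ c.support, ∑ w, n w = 0
def CondN {r : ℕ} (c : Table r) : Prop := c.sum (fun _ a => a) = 0
def CondA {r : ℕ} (B : ℝ) (c : Table r) : Prop :=
  c.sum (fun n a => ‖a‖ * Real.exp (∑ w, |(n w : ℝ)|)) ≤ B
def CondC {r : ℕ} (c₀ : ℝ) (c : Table r) : Prop :=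
  ∀ φ : W r → ℝ, c₀ * ∑ w, ∑ w', (1 - Real.cos (φ w - φ w')) ≤ (genF c φ).re
/-- (R) time-reflection (Osterwalder–Schrader) Hermiticity of the table. -/
def CondR {r : ℕ} (c : Table r) : Prop :=
  ∀ n : Freq r, c (fun w => n (w.1, w.2.1, Fin.rev w.2.2)) = (starRingEnd ℂ) (c (-n))
/-- (P) spatial-inversion evenness of the table. -/
def CondP {r : ℕ} (c : Table r) : Prop :=
  ∀ n : Freq r, c (fun w => n (Fin.rev w.1, Fin.rev w.2.1, w.2.2)) = c n
/-- the restated crux's admissible class. -/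
def AdmissibleRP (r : ℕ) (B c₀ : ℝ) (c : Table r) : Prop :=
  CondU1 c ∧ CondN c ∧ CondA B c ∧ CondC c₀ c ∧ CondR c ∧ CondP c

/-! ### the idea's objects -/

/-- slice magnetisation deficit `D(θ) = 1 − O(θ) = L⁻² Σ_x |e^{iθ(x,0)} − m|²`, `m` the slice mean. -/
def sliceD (L M : ℕ) [NeZero L] [NeZero M] (θ : Λ L M → ℝ) : ℝ := 1 - sliceO L M θ

/-- spatial Dirichlet energy of slice `0`: `E(θ₀) = Σ_x Σ_{i=1,2} (1 − cos(θ(x+eᵢ,0) − θ(x,0)))`. -/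
def sliceE (L M : ℕ) [NeZero L] [NeZero M] (θ : Λ L M → ℝ) : ℝ :=
  ∑ x : TorusSite 2 L, ∑ i : Fin 2, (1 - Real.cos (θ (x + Pi.single i 1, 0) - θ (x, 0)))

/-- the deficit-rewarded partition function `Z_h = ∫_cube e^{−A(θ)} · e^{h·D(θ)} dθ`. -/
def rewardZ {r : ℕ} (K h : ℝ) (c : Table r) (L M : ℕ) [NeZero L] [NeZero M] : ℂ :=
  MeasureTheory.integral (MeasureTheory.volume.restrict (cube L M))
    (fun θ => Complex.exp (-(action K c L M θ)) * ((Real.exp (h * sliceD L M θ) : ℝ) : ℂ))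

/-- P1 (elementary support lemma): Poincaré on `(ℤ/L)²`, `D ≤ E/8` for `L ≥ 2`. -/
def SlicePoincare : Prop :=
  ∀ (L M : ℕ) [NeZero L] [NeZero M], 2 ≤ L → ∀ θ : Λ L M → ℝ, sliceD L M θ ≤ sliceE L M θ / 8

/-- J (FIRST LEMMA of the line): Jensen under the positive even-`M` slice density (`r = 2`, class (R)).
For every `h > 0`: `Z` and `Z_h` are real `> 0` and `1 − log(Z_h/Z)/h ≤ ⟨O⟩`. -/
def JensenDeficitBound : Prop :=
  ∀ (c : Table 2), CondR c → ∀ (K h : ℝ), 0 < h → ∀ (L M : ℕ) [NeZero L] [NeZero M], Even M →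
    0 < (partZ K c L M).re ∧ 0 < (rewardZ K h c L M).re ∧
    1 - Real.log ((rewardZ K h c L M).re / (partZ K c L M).re) / h ≤ (numerO K c L M / partZ K c L M).re

/-- FE (the transferred crux content at `r = 2`): coercivity-budget free-energy stability — rewarding the slice
deficit with one quarter of slice 0's own coercive budget raises the free energy by at most a constant. -/
def CoerciveBudgetFreeEnergy : Prop :=
  ∀ (B c₀ : ℝ), 0 < c₀ → ∃ C K₀ : ℝ, ∃ L₀ : ℕ, ∀ K : ℝ, K₀ ≤ K → ∀ c : Table 2, AdmissibleRP 2 B c₀ c →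
    ∀ (L M : ℕ) [NeZero L] [NeZero M], L₀ ≤ L → L ≤ M → Even L → Even M →
      (rewardZ K (16 * c₀ * K) c L M).re ≤ Real.exp C * (partZ K c L M).re

/-- the `r = 2` slice of the crux, in the disprover's `Conclusion` form. -/
def CruxR2 : Prop :=
  ∀ (B c₀ : ℝ), 0 < c₀ → ∃ K₀ : ℝ, ∃ L₀ : ℕ, ∀ K : ℝ, K₀ ≤ K → ∀ c : Table 2, AdmissibleRP 2 B c₀ c →
    ∀ (L M : ℕ) [NeZero L] [NeZero M], L₀ ≤ L → L ≤ M → Even L → Even M → Conclusion K c L M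

/-- composition claim (crux-plan would prove it; pure real analysis: `⟨O⟩ ≥ 1 − C/(16c₀K)`): -/
def TransferClaim : Prop := CoerciveBudgetFreeEnergy → JensenDeficitBound → CruxR2

/-- sharper variant (infrared form): per-mode structure factor and its exponential-moment bound.
`O_k(θ) = L⁻⁴ |Σ_x e^{−ik·x} e^{iθ(x,0)}|²`, sum rule `Σ_k O_k = 1`, `⟨O_k⟩ ≤ log E_ρ[e^{h_k O_k}]/h_k`. -/
def sliceOk (L M : ℕ) [NeZero L] [NeZero M] (k : TorusSite 2 L) (θ : Λ L M → ℝ) : ℝ :=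
  ‖∑ x : TorusSite 2 L, Complex.exp (Complex.I * ((θ (x, 0) : ℂ) -
      2 * Real.pi * ∑ i : Fin 2, ((k i).val : ℝ) * ((x i).val : ℝ) / (L : ℝ)))‖ ^ 2 / (L : ℝ) ^ 4

/-- deterministic sum rule (Parseval on `(ℤ/L)²`). -/
def SumRule : Prop :=
  ∀ (L M : ℕ) [NeZero L] [NeZero M] (θ : Λ L M → ℝ), ∑ k : TorusSite 2 L, sliceOk L M k θ = 1

end

end Summit.HubbardSuperconductivity.HubbardSuperconductivity.Cruxes.BirComplexStableXYR.JensenBudget
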